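import Summits.BirchSwinnertonDyer.BirchSwinnertonDyer.Theorems.SignedLowerHalvesSmallImageLowerHalfBothSignsRttD2SeqSemilocMap
import Summits.BirchSwinnertonDyer.BirchSwinnertonDyer.Theorems.SignedLowerHalvesSmallImageLowerHalfBothSignsRttCharRoadE2JunctionMonotone
import HarnessLib

/-!
# Route `SignedLowerHalves`, crux L `SmallImageLowerHalfBothSigns` (stmt-BirchSwinnertonDyer-23599), line `rtt_w3` v24 — stub S3β (`stub_junctionPT_ns`), brick T2′:
# THE SEMILOCALISATION AT `S₀` AS ONE MAP `sloc_{S₀} : I.H →ₗ[Λ_𝒪] Π_{w∈S₀} 𝐇¹_{Iw,w}`, ITS KERNEL `= B′`, THE INJECTION `I.H ⧸ B′ ↪ Π_{w∈S₀} 𝐇¹_{Iw,w}` AND ★★★ `λ(I.H ⧸ B′) ≤ λ(Π_{w∈S₀} 𝐇¹_{Iw,w})`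

WIDTH seat `bsd-line-slh-p3-w3` g25 under LEAD `cruxlead-stmt-BirchSwinnertonDyer-23599` g13 (cell `bsd-ssimc`); helper `--supports stmt-BirchSwinnertonDyer-23599`
(design memo `Lines/rtt_w3-DESIGN-S3beta-w3-g25.md`, §1 (e)). DEFINITIONS WITH BODIES (`semilocMapPi`, `quotStrictCarrierToPi`) + THEOREMS; no named fact, no instance, no `sorry`.
Sequel of T2 (`…RttD2SeqSemilocMap`). The λ-inequality is the term `λ(I.H ⧸ range B′.subtype)` of the registered S3β/S3β″ text read on the semilocal side: it is bounded by the
λ-invariant of the semilocal Iwasawa module at `S₀` (when the latter is finitely generated torsion). HONEST FRAMING: bookkeeping; nothing about S3β, E2, crux L or BSD is proved.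

* §1 `semilocMapPi`, `ker_semilocMapPi` (`= strictCarrier I (strictLevel … S₀) _`), `quotStrictCarrierToPi` + injectivity, `range_subtype_strictCarrier`.
* §2 ★★★ `lambdaInvariant_quotient_strictCarrier_le` (pinned `Λ`-structures by restriction of scalars; `lambdaInvariant_le_of_injective_of_isTorsion_restrictScalars`).
References: [Rubin2000] Thm. 1.7.3, App. B.3; [Kato2004Asterisque] §17.13; [Washington1997] §13.2; [NeukirchSchmidtWingberg2008] (8.6.2)–(8.6.3).
-/

set_option autoImplicit false
set_option linter.dupNamespace false -- D-0017: single-problem summit, the namespace repeats the problem name by design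
noncomputable section

open scoped Classical PowerSeries
open NumberField IsDedekindDomain Field CategoryTheory Function

namespace Summit.BirchSwinnertonDyer.BirchSwinnertonDyer.Theorems.SmallImageRttD2Seq

open Literature.NumberTheory.EllipticCurves Literature.NumberTheory.GaloisRepresentations
  Literature.NumberTheory.ComplexMultiplication.EllipticUnits.JohnsonLeungKings2011
  Summit.BirchSwinnertonDyer.BirchSwinnertonDyer.Theorems.SmallImageRttD2J1
  Summit.BirchSwinnertonDyer.BirchSwinnertonDyer.Theorems.SmallImageRttD2J2

section Pi

variable {K : Type} [Field K] [NumberField K] {p : ℕ} [Fact p.Prime] {S : Set (PadicAlgCl p)} {κ : ZpExtension K p} {γ : absoluteGaloisGroup K}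
  {θ' : absoluteGaloisGroup K →ₜ* (padicCoeffIntegers S)ˣ} {P : Set (HeightOneSpectrum (𝓞 K))}
  (hNP : ∀ n, ramificationSubgroup K P ≤ κ.layerSubgroup n) (S₀ : Set (HeightOneSpectrum (𝓞 K)))
  (I : CycIwasawaCohomologyDataO S κ γ θ' P 1) (L : ∀ w : HeightOneSpectrum (𝓞 K), SemilocIwasawaCohomologyDataO S κ γ θ' P w 1)
  (hStr : ∀ (n k : ℕ) (f : IwasawaAlgebraO S) (y : cycLayerCohO S κ θ' P n k 1), y ∈ strictLevel S κ θ' P S₀ n k →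
    (letI := cycLayerModuleO S κ γ θ' P (show 1 ≤ 2 by norm_num) n k; f • y) ∈ strictLevel S κ θ' P S₀ n k)

/-! ## §1. The semilocalisation at `S₀` and its kernel -/

/-- **`sloc_{S₀} : I.H →ₗ[Λ_𝒪] Π_{w∈S₀} 𝐇¹_{Iw,w}`**, the product of the semilocalisations at the places of `S₀` (T2 `semilocMap`). [cite: Rubin2000, App. B.3] [cite: Kato2004Asterisque, §17.13] -/
def semilocMapPi : I.H →ₗ[IwasawaAlgebraO S] (∀ w : S₀, (L w).H) :=
  LinearMap.pi fun w ↦ semilocMap hNP I (L w)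

/-- Components of `sloc_{S₀}`. [folklore] -/
theorem semilocMapPi_apply (b : I.H) (w : S₀) : semilocMapPi hNP S₀ I L b w = semilocMap hNP I (L w) b := rfl

/-- ★★ **`ker sloc_{S₀} = B′`** (T2 `mem_strictCarrier_iff_forall_semilocMap_eq_zero`). [cite: Rubin2000, Thm. 1.7.3] [cite: NeukirchSchmidtWingberg2008, (8.6.2)–(8.6.3)] -/
theorem ker_semilocMapPi : LinearMap.ker (semilocMapPi hNP S₀ I L) = strictCarrier I (strictLevel S κ θ' P S₀) hStr := by
  ext b
  rw [LinearMap.mem_ker, mem_strictCarrier_iff_forall_semilocMap_eq_zero hNP S₀ I L hStr]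
  constructor
  · intro h w hw
    have hw' := congrFun h ⟨w, hw⟩
    rwa [semilocMapPi_apply, Pi.zero_apply] at hw'
  · intro h
    funext w
    rw [semilocMapPi_apply, Pi.zero_apply]
    exact h w w.2

/-- **The injection `I.H ⧸ B′ ↪ Π_{w∈S₀} 𝐇¹_{Iw,w}`** induced by `sloc_{S₀}`. [cite: Rubin2000, App. B.3] -/
def quotStrictCarrierToPi : (I.H ⧸ strictCarrier I (strictLevel S κ θ' P S₀) hStr) →ₗ[IwasawaAlgebraO S] (∀ w : S₀, (L w).H) :=
  (strictCarrier I (strictLevel S κ θ' P S₀) hStr).liftQ (semilocMapPi hNP S₀ I L) (le_of_eq (ker_semilocMapPi hNP S₀ I L hStr).symm)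

/-- `quotStrictCarrierToPi [b] = sloc_{S₀} b`. [folklore] -/
theorem quotStrictCarrierToPi_mk (b : I.H) :
    quotStrictCarrierToPi hNP S₀ I L hStr (Submodule.Quotient.mk b) = semilocMapPi hNP S₀ I L b := rfl

/-- ★ **`I.H ⧸ B′ ↪ Π_{w∈S₀} 𝐇¹_{Iw,w}` is injective.** [cite: Rubin2000, Thm. 1.7.3, App. B.3] -/
theorem quotStrictCarrierToPi_injective : Function.Injective (quotStrictCarrierToPi hNP S₀ I L hStr) := by
  rw [← LinearMap.ker_eq_bot, quotStrictCarrierToPi, Submodule.ker_liftQ, ker_semilocMapPi hNP S₀ I L hStr, Submodule.mkQ_map_self]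

/-- `range B′.subtype = B′`, so that the registered term `I.H ⧸ range (Submodule.subtype B′)` is `I.H ⧸ B′`. [folklore] -/
theorem quotient_range_subtype_linearEquiv :
    Nonempty ((I.H ⧸ LinearMap.range (Submodule.subtype (strictCarrier I (strictLevel S κ θ' P S₀) hStr))) ≃ₗ[IwasawaAlgebraO S]
      (I.H ⧸ strictCarrier I (strictLevel S κ θ' P S₀) hStr)) :=
  ⟨Submodule.quotEquivOfEq _ _ (Submodule.range_subtype _)⟩

/-! ## §2. `λ(I.H ⧸ B′) ≤ λ(Π_{w∈S₀} 𝐇¹_{Iw,w})` -/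

/-- ★★★ **`λ(I.H ⧸ B′) ≤ λ(Π_{w∈S₀} 𝐇¹_{Iw,w})`** whenever the semilocal product is finitely generated torsion over `Λ` (through the restriction-of-scalars structures
`moduleIwasawa`): the term `λ(I.H ⧸ range B′.subtype)` of S3β is bounded by the λ-invariant of the semilocal Iwasawa module at `S₀`. [cite: Washington1997, §13.2] [cite: Rubin2000, Thm. 1.7.3] -/
theorem lambdaInvariant_quotient_strictCarrier_le (hNP : ∀ n, ramificationSubgroup K P ≤ κ.layerSubgroup n)
    (hfin : letI : ∀ w : HeightOneSpectrum (𝓞 K), Module (IwasawaAlgebra p) (L w).H := fun w ↦ (L w).moduleIwasawa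
      Module.Finite (IwasawaAlgebra p) (∀ w : S₀, (L w).H))
    (htors : letI : ∀ w : HeightOneSpectrum (𝓞 K), Module (IwasawaAlgebra p) (L w).H := fun w ↦ (L w).moduleIwasawa
      Module.IsTorsion (IwasawaAlgebra p) (∀ w : S₀, (L w).H)) :
    letI := I.moduleIwasawa
    letI : ∀ w : HeightOneSpectrum (𝓞 K), Module (IwasawaAlgebra p) (L w).H := fun w ↦ (L w).moduleIwasawa
    letI := (iwasawaToIwasawaO S).toAlgebra
    haveI := I.isScalarTower_moduleIwasawa
    lambdaInvariant p (I.H ⧸ LinearMap.range (Submodule.subtype (strictCarrier I (strictLevel S κ θ' P S₀) hStr))) ≤ lambdaInvariant p (∀ w : S₀, (L w).H) := by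
  letI := I.moduleIwasawa
  letI : ∀ w : HeightOneSpectrum (𝓞 K), Module (IwasawaAlgebra p) (L w).H := fun w ↦ (L w).moduleIwasawa
  letI := (iwasawaToIwasawaO S).toAlgebra
  haveI := I.isScalarTower_moduleIwasawa
  haveI : ∀ w : HeightOneSpectrum (𝓞 K), IsScalarTower (IwasawaAlgebra p) (IwasawaAlgebraO S) (L w).H := fun w ↦ (L w).isScalarTower_moduleIwasawa
  haveI := hfin
  have e : (I.H ⧸ LinearMap.range (Submodule.subtype (strictCarrier I (strictLevel S κ θ' P S₀) hStr))) ≃ₗ[IwasawaAlgebraO S]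
      (I.H ⧸ strictCarrier I (strictLevel S κ θ' P S₀) hStr) := Submodule.quotEquivOfEq _ _ (Submodule.range_subtype _)
  rw [lambdaInvariant_eq_of_linearEquiv (e.restrictScalars (IwasawaAlgebra p))]
  exact SmallImageRttCharRoad.lambdaInvariant_le_of_injective_of_isTorsion_restrictScalars (quotStrictCarrierToPi hNP S₀ I L hStr)
    (quotStrictCarrierToPi_injective hNP S₀ I L hStr) htors

end Pi

end Summit.BirchSwinnertonDyer.BirchSwinnertonDyer.Theorems.SmallImageRttD2Seq

end
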